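import Mathlib.Geometry.Manifold.Instances.Real
import Mathlib.Geometry.Manifold.MFDeriv.Tangent
import Mathlib.Geometry.Manifold.MFDeriv.Atlas
import Mathlib.Analysis.InnerProductSpace.PiL2
import Mathlib.Analysis.Normed.Module.Alternating.Basic
import Literature.Geometry.Kaehler.ManifoldForms

/-!
# SmoothPoincare4 / SullivanDual — the taming cone is algebraically open (helper)

Helper file for item stmt-SmoothPoincare4-7827 (`RelativeSullivanDuality`, support of route
SullivanDual). For a `4`-manifold `N` (charted on `ℝ⁴`, `IsManifold (𝓡 4) ∞ N`), a field of
endomorphisms `J x : T_x N → T_x N` smooth in the sense of the route items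
(`ContMDiffAt` of `inTangentCoordinates … J x₀` at `x₀`), and smooth `2`-forms `α`, `β`
(`Literature.Geometry.Kaehler.IsSmoothForm`), we prove the analytic heart of Sullivan's duality
on the side of forms: if `α` tames `J` on a compact set `K` (`α_x(v, J_x v) > 0`, `v ≠ 0`,
`x ∈ K`) then so does `α + t • β` for all `|t| ≤ δ`, some `δ > 0`
(`exists_uniform_tames_add_smul`). In the trivialisation at `x₀` the quantity
`α_x(v, J_x v)` reads `α̂(x)(u, Ĵ(x) u)` with `u = De_{x₀}(x) v` (`form_apply_eq_inChart`), where
`α̂ = α.inChart x₀ ∘ e_{x₀}` and `Ĵ = inTangentCoordinates … J x₀` are continuous at `x₀`; a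
positive minimum on the unit sphere at `x₀` and operator-norm estimates give the local statement
(`exists_nhds_tames_add_smul`), and `IsCompact.induction_on` globalises it.

References: D. Sullivan, Invent. Math. 36 (1976), Thm. I.7 (openness of the cone of transversal
forms); standard. No named facts are used.
-/

-- the prescribed namespace `Summit.<P>.<Sub>.…` duplicates `SmoothPoincare4` (P = Sub)
set_option linter.dupNamespace false

noncomputable section

namespace Summit.SmoothPoincare4.SmoothPoincare4.Theorems

open scoped Manifold ContDiff Topology
open Set Filter Literature.Geometry.Kaehler

/-! ### Two-form algebra on `ℝ⁴` -/

/-- Operator-norm bound for a continuous alternating `2`-form on two vectors: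
`|A(u, w)| ≤ ‖A‖ ‖u‖ ‖w‖`. [folklore] -/
theorem norm_twoForm_apply_le (A : EuclideanSpace ℝ (Fin 4) [⋀^Fin 2]→L[ℝ] ℝ)
    (u w : EuclideanSpace ℝ (Fin 4)) : ‖A ![u, w]‖ ≤ ‖A‖ * (‖u‖ * ‖w‖) := by
  have h := A.le_opNorm ![u, w]
  simpa [Fin.prod_univ_two] using h

/-- Linearity of a `2`-form in its second slot: `A(u, w) - A(u, w') = A(u, w - w')`.
[folklore] -/
theorem twoForm_apply_sub_right (A : EuclideanSpace ℝ (Fin 4) [⋀^Fin 2]→L[ℝ] ℝ)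
    (u w w' : EuclideanSpace ℝ (Fin 4)) : A ![u, w] - A ![u, w'] = A ![u, w - w'] := by
  have e : ∀ z : EuclideanSpace ℝ (Fin 4),
      Function.update ![u, (0 : EuclideanSpace ℝ (Fin 4))] 1 z = ![u, z] := by
    intro z
    funext i
    fin_cases i <;> simp
  have h := A.map_update_sub ![u, (0 : EuclideanSpace ℝ (Fin 4))] 1 w w'
  simp only [e] at h
  exact h.symm

/-- Homogeneity of a `2`-form: `A(c u, c w) = c² A(u, w)`. [folklore] -/
theorem twoForm_apply_smul_smul (A : EuclideanSpace ℝ (Fin 4) [⋀^Fin 2]→L[ℝ] ℝ) (c : ℝ)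
    (u w : EuclideanSpace ℝ (Fin 4)) : A ![c • u, c • w] = c ^ 2 * A ![u, w] := by
  have h := A.toContinuousMultilinearMap.map_smul_univ (fun _ => c) ![u, w]
  have e : (fun i => (fun _ : Fin 2 => c) i • ![u, w] i) = ![c • u, c • w] := by
    funext i
    fin_cases i <;> simp
  rw [e] at h
  simpa [Finset.prod_const] using h

/-! ### Reading `α_x(v, J_x v)` in the trivialisation at `x₀` -/

variable {N : Type*} [TopologicalSpace N] [ChartedSpace (EuclideanSpace ℝ (Fin 4)) N]
  [IsManifold (𝓡 4) ∞ N]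

/-- **Chart identity.** For `x` in the chart source of `x₀`, a `2`-form `α`, an endomorphism
field `J` and `v ∈ T_x N`: `α_x(v, J_x v) = α̂(e x)(P v, Ĵ(x)(P v))`, where `e = extChartAt x₀`,
`α̂ = α.inChart x₀` is the chart representative of `α` (Warner 1983, §2.18), `P = De(x)` and
`Ĵ = inTangentCoordinates … J x₀` (Mathlib). Proof: `Ĵ(x) = P ∘ J_x ∘ P⁻¹` with
`P⁻¹ = D(e⁻¹)(e x)` (`inTangentCoordinates_eq_mfderiv_comp`), and `α̂(e x)` is `α_x` precomposed
with `P⁻¹` in each slot. [folklore] -/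
theorem form_apply_eq_inChart (x₀ : N) {x : N}
    (hx : x ∈ (chartAt (EuclideanSpace ℝ (Fin 4)) x₀).source)
    (α : MForm (𝓡 4) N ℝ 2)
    (J : ∀ y : N, TangentSpace (𝓡 4) y →L[ℝ] TangentSpace (𝓡 4) y)
    (v : TangentSpace (𝓡 4) x) :
    α x ![v, J x v] = α.inChart x₀ (extChartAt (𝓡 4) x₀ x)
      ![mfderiv (𝓡 4) 𝓘(ℝ, EuclideanSpace ℝ (Fin 4)) (extChartAt (𝓡 4) x₀) x v,
        inTangentCoordinates (𝓡 4) (𝓡 4) (id : N → N) id (fun y => J y) x₀ x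
          (mfderiv (𝓡 4) 𝓘(ℝ, EuclideanSpace ℝ (Fin 4)) (extChartAt (𝓡 4) x₀) x v)] := by
  have hxe : x ∈ (extChartAt (𝓡 4) x₀).source := by rwa [extChartAt_source]
  rw [MForm.inChart_apply]
  set P := mfderiv (𝓡 4) 𝓘(ℝ, EuclideanSpace ℝ (Fin 4)) (extChartAt (𝓡 4) x₀) x with hP
  set Pinv := mfderivWithin 𝓘(ℝ, EuclideanSpace ℝ (Fin 4)) (𝓡 4) (extChartAt (𝓡 4) x₀).symm
    (range (𝓡 4)) (extChartAt (𝓡 4) x₀ x) with hPinv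
  have hPinvP : ∀ w, Pinv (P w) = w := fun w => by
    have h := mfderivWithin_extChartAt_symm_comp_mfderiv_extChartAt' (I := 𝓡 4) hxe
    exact DFunLike.congr_fun h w
  have hJhat : inTangentCoordinates (𝓡 4) (𝓡 4) (id : N → N) id (fun y => J y) x₀ x =
      P ∘L J x ∘L Pinv :=
    inTangentCoordinates_eq_mfderiv_comp (I := 𝓡 4) (I' := 𝓡 4) (f := (id : N → N)) (g := id)
      hx hx
  have hleft : (extChartAt (𝓡 4) x₀).symm (extChartAt (𝓡 4) x₀ x) = x :=
    (extChartAt (𝓡 4) x₀).left_inv hxe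
  have key : ∀ (y : N) (_ : y = x) (m : Fin 2 → EuclideanSpace ℝ (Fin 4)), α y m = α x m := by
    rintro y rfl m
    rfl
  have hPinvP' : ∀ w, Pinv ((P ∘L J x ∘L Pinv) (P w)) = J x w := fun w => by
    have e1 : (P ∘L J x ∘L Pinv) (P w) = P (J x (Pinv (P w))) := rfl
    rw [e1, hPinvP w]
    exact hPinvP (J x w)
  rw [key _ hleft, hJhat]
  congr 1
  funext i
  fin_cases i
  · simp only [Fin.zero_eta, Fin.isValue, Matrix.cons_val_zero]
    exact (hPinvP v).symm
  · simp only [Fin.mk_one, Fin.isValue, Matrix.cons_val_one, Matrix.cons_val_fin_one]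
    exact (hPinvP' v).symm

/-! ### Local and compact openness of the taming condition -/

/-- **Local uniform taming.** If `α_{x₀}(v, J_{x₀} v) > 0` for `v ≠ 0`, with `α`, `β` smooth
`2`-forms and `J` smooth at `x₀` in the trivialisation at `x₀`, then there are a neighbourhood
`U` of `x₀` and `δ > 0` with `(α + tβ)_x(v, J_x v) > 0` for all `|t| ≤ δ`, `x ∈ U`, `v ≠ 0`.
Proof: read everything in the chart at `x₀` (`form_apply_eq_inChart`); the representatives
`α̂, β̂` (`MForm.inChart`, `C^∞` hence continuous at `e x₀`) and `Ĵ` are continuous at `x₀`;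
`u ↦ α̂(x₀)(u, Ĵ(x₀)u)` has a positive minimum `m` on the unit sphere of `ℝ⁴`; operator-norm
estimates give `α̂(x)(u, Ĵ(x)u) ≥ m/2` and `|β̂(x)(u, Ĵ(x)u)| ≤ M` near `x₀`, whence the claim
with `δ = m / (4(M+1))` by homogeneity in `u`. (Sullivan 1976, Thm. I.7: the cone of
transversal forms is open.) [folklore] -/
theorem exists_nhds_tames_add_smul (x₀ : N) {α β : MForm (𝓡 4) N ℝ 2}
    (hα : IsSmoothForm α) (hβ : IsSmoothForm β)
    (J : ∀ y : N, TangentSpace (𝓡 4) y →L[ℝ] TangentSpace (𝓡 4) y)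
    (hJ : ContMDiffAt (𝓡 4) 𝓘(ℝ, EuclideanSpace ℝ (Fin 4) →L[ℝ] EuclideanSpace ℝ (Fin 4)) ∞
      (inTangentCoordinates (𝓡 4) (𝓡 4) (id : N → N) id (fun y => J y) x₀) x₀)
    (hpos : ∀ v : TangentSpace (𝓡 4) x₀, v ≠ 0 → 0 < α x₀ ![v, J x₀ v]) :
    ∃ U ∈ 𝓝 x₀, ∃ δ : ℝ, 0 < δ ∧ ∀ t : ℝ, |t| ≤ δ → ∀ x ∈ U,
      ∀ v : TangentSpace (𝓡 4) x, v ≠ 0 → 0 < (α + t • β) x ![v, J x v] := by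
  -- chart data at `x₀`
  set Jh : N → EuclideanSpace ℝ (Fin 4) →L[ℝ] EuclideanSpace ℝ (Fin 4) :=
    inTangentCoordinates (𝓡 4) (𝓡 4) (id : N → N) id (fun y => J y) x₀ with hJh_def
  set Qh : N → EuclideanSpace ℝ (Fin 4) [⋀^Fin 2]→L[ℝ] ℝ :=
    fun x => α.inChart x₀ (extChartAt (𝓡 4) x₀ x) with hQh_def
  set Bh : N → EuclideanSpace ℝ (Fin 4) [⋀^Fin 2]→L[ℝ] ℝ :=
    fun x => β.inChart x₀ (extChartAt (𝓡 4) x₀ x) with hBh_def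
  -- continuity at `x₀`
  have hr : range (𝓡 4) = (univ : Set (EuclideanSpace ℝ (Fin 4))) :=
    ModelWithCorners.Boundaryless.range_eq_univ
  have hQc : ContinuousAt Qh x₀ := by
    have h1 : ContinuousAt (α.inChart x₀) (extChartAt (𝓡 4) x₀ x₀) := by
      have h := (hα x₀).continuousWithinAt
      rwa [hr, continuousWithinAt_univ] at h
    exact h1.comp (continuousAt_extChartAt x₀)
  have hBc : ContinuousAt Bh x₀ := by
    have h1 : ContinuousAt (β.inChart x₀) (extChartAt (𝓡 4) x₀ x₀) := by
      have h := (hβ x₀).continuousWithinAt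
      rwa [hr, continuousWithinAt_univ] at h
    exact h1.comp (continuousAt_extChartAt x₀)
  have hJc : ContinuousAt Jh x₀ := hJ.continuousAt
  -- the chart identity, for the perturbed form
  have hident : ∀ (t : ℝ) (x : N), x ∈ (chartAt (EuclideanSpace ℝ (Fin 4)) x₀).source →
      ∀ v : TangentSpace (𝓡 4) x, (α + t • β) x ![v, J x v] =
        Qh x ![mfderiv (𝓡 4) 𝓘(ℝ, EuclideanSpace ℝ (Fin 4)) (extChartAt (𝓡 4) x₀) x v,
            Jh x (mfderiv (𝓡 4) 𝓘(ℝ, EuclideanSpace ℝ (Fin 4)) (extChartAt (𝓡 4) x₀) x v)] +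
          t * Bh x ![mfderiv (𝓡 4) 𝓘(ℝ, EuclideanSpace ℝ (Fin 4)) (extChartAt (𝓡 4) x₀) x v,
            Jh x (mfderiv (𝓡 4) 𝓘(ℝ, EuclideanSpace ℝ (Fin 4)) (extChartAt (𝓡 4) x₀) x v)] := by
    intro t x hx v
    rw [form_apply_eq_inChart x₀ hx (α + t • β) J v, MForm.inChart_add, MForm.inChart_smul]
    rfl
  -- at `x₀` the chart identity is the identity
  have hid0 : ∀ u : EuclideanSpace ℝ (Fin 4), Qh x₀ ![u, Jh x₀ u] = α x₀ ![u, J x₀ u] := by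
    intro u
    have h := form_apply_eq_inChart x₀ (mem_chart_source _ x₀) α J u
    rw [mfderiv_extChartAt_self] at h
    exact h.symm
  -- positive minimum on the unit sphere at `x₀`
  set g : EuclideanSpace ℝ (Fin 4) → ℝ := fun u => Qh x₀ ![u, Jh x₀ u] with hg_def
  have hgc : Continuous g := by
    have h1 : Continuous fun u : EuclideanSpace ℝ (Fin 4) => ![u, Jh x₀ u] := by
      refine continuous_pi fun i => ?_
      fin_cases i
      · exact continuous_id
      · exact (Jh x₀).continuous
    exact (Qh x₀).coe_continuous.comp h1
  obtain ⟨u₀, hu₀S, hu₀min⟩ := (isCompact_sphere (0 : EuclideanSpace ℝ (Fin 4)) 1).exists_isMinOn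
    ((NormedSpace.sphere_nonempty).2 zero_le_one) hgc.continuousOn
  set m : ℝ := g u₀ with hm_def
  have hm : 0 < m := by
    have hu₀ : u₀ ≠ 0 := by
      intro h
      rw [h, mem_sphere_zero_iff_norm, norm_zero] at hu₀S
      exact zero_ne_one hu₀S
    rw [hm_def, hg_def]
    simp only
    rw [hid0]
    exact hpos u₀ hu₀
  have hmle : ∀ u : EuclideanSpace ℝ (Fin 4), ‖u‖ = 1 → m ≤ Qh x₀ ![u, Jh x₀ u] := by
    intro u hu
    exact hu₀min (show u ∈ Metric.sphere (0 : EuclideanSpace ℝ (Fin 4)) 1 from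
      mem_sphere_zero_iff_norm.2 hu)
  -- the neighbourhood
  set err : N → ℝ := fun x => ‖Qh x - Qh x₀‖ * ‖Jh x‖ + ‖Qh x₀‖ * ‖Jh x - Jh x₀‖ with herr_def
  set bnd : N → ℝ := fun x => ‖Bh x‖ * ‖Jh x‖ with hbnd_def
  set Mb : ℝ := ‖Bh x₀‖ * ‖Jh x₀‖ + 1 with hMb_def
  have herrc : ContinuousAt err x₀ :=
    ((hQc.sub continuousAt_const).norm.mul hJc.norm).add
      (continuousAt_const.mul (hJc.sub continuousAt_const).norm)
  have hbndc : ContinuousAt bnd x₀ := hBc.norm.mul hJc.norm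
  have herr0 : err x₀ < m / 2 := by
    simp only [herr_def, sub_self, norm_zero, zero_mul, mul_zero, add_zero]
    linarith
  have hbnd0 : bnd x₀ < Mb := by simp [hbnd_def, hMb_def]
  have hev1 : ∀ᶠ x in 𝓝 x₀, err x < m / 2 := herrc.eventually_lt continuousAt_const herr0
  have hev2 : ∀ᶠ x in 𝓝 x₀, bnd x < Mb := hbndc.eventually_lt continuousAt_const hbnd0
  have hev3 : ∀ᶠ x in 𝓝 x₀, x ∈ (chartAt (EuclideanSpace ℝ (Fin 4)) x₀).source :=
    chart_source_mem_nhds _ x₀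
  have hMb : 0 < Mb := by
    have : 0 ≤ ‖Bh x₀‖ * ‖Jh x₀‖ := by positivity
    simp only [hMb_def]; linarith
  refine ⟨{x | err x < m / 2 ∧ bnd x < Mb ∧ x ∈ (chartAt (EuclideanSpace ℝ (Fin 4)) x₀).source},
    (hev1.and (hev2.and hev3)), m / (4 * (Mb + 1)), by positivity, ?_⟩
  intro t ht x hx v hv
  obtain ⟨hxerr, hxbnd, hxs⟩ := hx
  -- estimates on the unit sphere at `x`
  have hunit : ∀ u : EuclideanSpace ℝ (Fin 4), ‖u‖ = 1 →
      0 < Qh x ![u, Jh x u] + t * Bh x ![u, Jh x u] := by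
    intro u hu
    -- lower bound for the `α̂`-term
    have h1 : |Qh x ![u, Jh x u] - Qh x₀ ![u, Jh x u]| ≤ ‖Qh x - Qh x₀‖ * ‖Jh x‖ := by
      rw [← ContinuousAlternatingMap.sub_apply, ← Real.norm_eq_abs]
      refine (norm_twoForm_apply_le _ _ _).trans ?_
      rw [hu, one_mul]
      exact mul_le_mul_of_nonneg_left
        ((Jh x).le_opNorm u |>.trans (by rw [hu, mul_one])) (norm_nonneg _)
    have h2 : |Qh x₀ ![u, Jh x u] - Qh x₀ ![u, Jh x₀ u]| ≤ ‖Qh x₀‖ * ‖Jh x - Jh x₀‖ := by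
      have esub : Jh x u - Jh x₀ u = (Jh x - Jh x₀) u := rfl
      rw [twoForm_apply_sub_right, ← Real.norm_eq_abs, esub]
      refine (norm_twoForm_apply_le _ _ _).trans ?_
      rw [hu, one_mul]
      exact mul_le_mul_of_nonneg_left
        ((Jh x - Jh x₀).le_opNorm u |>.trans (by rw [hu, mul_one])) (norm_nonneg _)
    have h3 : |Bh x ![u, Jh x u]| ≤ bnd x := by
      rw [← Real.norm_eq_abs]
      refine (norm_twoForm_apply_le _ _ _).trans ?_
      rw [hu, one_mul]
      exact mul_le_mul_of_nonneg_left
        ((Jh x).le_opNorm u |>.trans (by rw [hu, mul_one])) (norm_nonneg _)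
    have h4 := hmle u hu
    have h5 : m / 2 ≤ Qh x ![u, Jh x u] := by
      have e : Qh x ![u, Jh x u] = Qh x₀ ![u, Jh x₀ u] +
          ((Qh x ![u, Jh x u] - Qh x₀ ![u, Jh x u]) +
            (Qh x₀ ![u, Jh x u] - Qh x₀ ![u, Jh x₀ u])) := by ring
      rw [e]
      have := abs_le.1 h1
      have := abs_le.1 h2
      simp only [herr_def] at hxerr
      linarith [abs_le.1 h1, abs_le.1 h2]
    have h6 : |t * Bh x ![u, Jh x u]| ≤ m / 4 := by
      rw [abs_mul]
      have hb : |Bh x ![u, Jh x u]| ≤ Mb := h3.trans hxbnd.le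
      calc |t| * |Bh x ![u, Jh x u]| ≤ m / (4 * (Mb + 1)) * Mb :=
            mul_le_mul ht hb (abs_nonneg _) (by positivity)
        _ ≤ m / 4 := by
            rw [div_mul_eq_mul_div, div_le_div_iff₀ (by positivity) (by positivity)]
            nlinarith
    linarith [(abs_le.1 h6).1]
  -- transfer to `v ≠ 0` through `P = De(x)` and homogeneity
  set P := mfderiv (𝓡 4) 𝓘(ℝ, EuclideanSpace ℝ (Fin 4)) (extChartAt (𝓡 4) x₀) x with hP
  have hxe : x ∈ (extChartAt (𝓡 4) x₀).source := by rwa [extChartAt_source]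
  have hPv : P v ≠ 0 := by
    intro h0
    apply hv
    have h := mfderivWithin_extChartAt_symm_comp_mfderiv_extChartAt' (I := 𝓡 4) hxe
    have h' : mfderivWithin 𝓘(ℝ, EuclideanSpace ℝ (Fin 4)) (𝓡 4) (extChartAt (𝓡 4) x₀).symm
        (range (𝓡 4)) (extChartAt (𝓡 4) x₀ x) (P v) = v := DFunLike.congr_fun h v
    rw [h0, map_zero] at h'
    exact h'.symm
  set w : EuclideanSpace ℝ (Fin 4) := P v with hw
  set u : EuclideanSpace ℝ (Fin 4) := ‖w‖⁻¹ • w with hu_def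
  have hwpos : 0 < ‖w‖ := norm_pos_iff.2 hPv
  have hu1 : ‖u‖ = 1 := by
    rw [hu_def, norm_smul, norm_inv, norm_norm, inv_mul_cancel₀ hwpos.ne']
  have hwu : w = ‖w‖ • u := by
    rw [hu_def, smul_smul, mul_inv_cancel₀ hwpos.ne', one_smul]
  rw [hident t x hxs v]
  change 0 < Qh x ![w, Jh x w] + t * Bh x ![w, Jh x w]
  rw [hwu, map_smul, twoForm_apply_smul_smul, twoForm_apply_smul_smul]
  have := hunit u hu1
  have hsq : 0 < ‖w‖ ^ 2 := by positivity
  nlinarith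

/-- **Compact uniform taming** (the cone of `J`-taming forms is algebraically open):
if the smooth `2`-form `α` tames `J` at every point of a compact set `K` then, for every smooth
`2`-form `β`, `α + t • β` tames `J` on `K` for all `|t| ≤ δ`, for some `δ > 0`. Local version
`exists_nhds_tames_add_smul` + `IsCompact.induction_on`. (Sullivan 1976, Thm. I.7.)
[folklore] -/
theorem exists_uniform_tames_add_smul {K : Set N} (hK : IsCompact K) {α β : MForm (𝓡 4) N ℝ 2}
    (hα : IsSmoothForm α) (hβ : IsSmoothForm β)
    (J : ∀ y : N, TangentSpace (𝓡 4) y →L[ℝ] TangentSpace (𝓡 4) y)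
    (hJ : ∀ x₀ : N, ContMDiffAt (𝓡 4) 𝓘(ℝ, EuclideanSpace ℝ (Fin 4) →L[ℝ] EuclideanSpace ℝ (Fin 4))
      ∞ (inTangentCoordinates (𝓡 4) (𝓡 4) (id : N → N) id (fun y => J y) x₀) x₀)
    (hpos : ∀ x ∈ K, ∀ v : TangentSpace (𝓡 4) x, v ≠ 0 → 0 < α x ![v, J x v]) :
    ∃ δ : ℝ, 0 < δ ∧ ∀ t : ℝ, |t| ≤ δ → ∀ x ∈ K,
      ∀ v : TangentSpace (𝓡 4) x, v ≠ 0 → 0 < (α + t • β) x ![v, J x v] := by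
  refine hK.induction_on
    (p := fun S => ∃ δ : ℝ, 0 < δ ∧ ∀ t : ℝ, |t| ≤ δ → ∀ x ∈ S,
      ∀ v : TangentSpace (𝓡 4) x, v ≠ 0 → 0 < (α + t • β) x ![v, J x v]) ?_ ?_ ?_ ?_
  · exact ⟨1, one_pos, fun t _ x hx => (Set.notMem_empty x hx).elim⟩
  · rintro S T hST ⟨δ, hδ, h⟩
    exact ⟨δ, hδ, fun t ht x hx => h t ht x (hST hx)⟩
  · rintro S T ⟨δ₁, hδ₁, h₁⟩ ⟨δ₂, hδ₂, h₂⟩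
    refine ⟨min δ₁ δ₂, lt_min hδ₁ hδ₂, fun t ht x hx => ?_⟩
    rcases hx with hx | hx
    · exact h₁ t (ht.trans (min_le_left _ _)) x hx
    · exact h₂ t (ht.trans (min_le_right _ _)) x hx
  · intro x₀ hx₀
    obtain ⟨U, hU, δ, hδ, h⟩ := exists_nhds_tames_add_smul x₀ hα hβ J (hJ x₀) (hpos x₀ hx₀)
    exact ⟨U, mem_nhdsWithin_of_mem_nhds hU, δ, hδ, h⟩

end Summit.SmoothPoincare4.SmoothPoincare4.Theorems
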